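import Literature.MathematicalPhysics.QuantumFieldTheory.Balaban1983to89.B1Eq333Decomposition

/-!
# `Balaban1983to89.B1Eq349Proof` — T. Bałaban, *(Higgs)₂,₃ quantum fields in a finite volume. I. A lower bound*,
Commun. Math. Phys. **85** (1982) 603–626 [Balaban1982Higgs1]: **(3.49)** p. 621, the effect of the scalar-field translation
(3.48) on the background field `φ^{(k)}` — `φ^{(k)} = φ′^{(k)} + ψ^{(k+1)}` — PROVED as a MODEL INSTANCE on the tree's concrete
one-step carrier of B1 Sect. 2, `B1RG242.StepData` (finite lattices, operators as real matrices), where it is the scalar-field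
reading of the already kernel-checked (3.42) (`B1Eq333Decomposition.eq342`); theorems only

statement-level skeleton of published theorems with citation tags; proofs where landed; nothing here is a claim about the Yang–Mills mass gap

PDF held: `paper:balaban1982-cmp85-higgs23-i` (journal page = PDF page + 602); (3.48)–(3.49) p. 621 and (3.41)–(3.42) p. 619
READ AS IMAGES on the x2 renders `run/shared/lean/pub/pub-balaban/b2b-balaban-ref1/pages/1982-cmp85-higgs23-I/…-p019-x2.png`,
`…-p017-x2.png`.

CITATION HEADER (lean-in-tree rule).  WHAT IS REPRODUCED — SKELETON row **B1.Eq3.48–3.49** (reader r12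
`lit-balaban-r12/ROWS-B1-part2.md`: «TRANSLATION φ = φ′ + aL⁻²C^{(k)}(B^{(k+1)})Q*(B^{(k+1)})ψ; φ^{(k)} = φ′^{(k)} + ψ^{(k+1)}
(via (2.66), (3.70) [sic]); typed p239973 (`B1Sect3Statements.transl310`)»).  Verbatim, p. 621 [PDF 19]: *"Now we will do a
translation in the fields φ. The translation has the form φ = φ′ + aL⁻²C^{(k)}(B^{(k+1)})Q*(B^{(k+1)})ψ, (3.48) and it
separates again the basic quadratic form for scalar fields into a sum of the corresponding forms in the fields ψ and φ′.
The rest of the action changes in an obvious manner. Let us notice that if (3.48) is done in φ^{(k)} =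
a_kG_k(B^{(k+1)})Q*_k(B^{(k+1)})φ, then we use (2.66), (3.70) and we get φ^{(k)} = φ′^{(k)} + ψ^{(k+1)}. (3.49)"* — the
references "(2.66), (3.70)" do not exist in this paper (r12 transcript note T4; Sect. 2 ends at (2.43), Sect. 3 at (3.69));
by content they are the renormalization group identities (2.41)–(2.42) p. 612, exactly as in the vector-field twin (3.42)
p. 619: *"A^{(k)} = a_kG_kQ*_kA′ + a_kaL⁻²G_kQ*_kC^{(k)}Q*B = a_kG_kQ*_kA′ + a_{k+1}L⁻²G^η_{k+1}Q*_{k+1}B = A′^{(k)} + B^{(k+1)}.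
(3.42)"*; the fields `φ′^{(k)} = a_kG_k(B^{(k+1)})Q*_k(B^{(k+1)})φ′` and `ψ^{(k+1)} = a_{k+1}L⁻²G_{k+1}(B^{(k+1)})Q*_{k+1}(B^{(k+1)})ψ`
are (3.29) p. 617 (in the units of the unit lattice `T₁^{(k)}` of p. 619) for `φ′` at level `k` and for `ψ` at level `k + 1`
(cf. (3.52) p. 621, `B1Ineq352Proof`).

THE MODEL INSTANCE.  `B1RG242.StepData ℝ ι κ ν` (one step k → k+1; `ι ⊃ κ ⊃ ν` ↤ the η-lattice, `T₁^{(k)}`, `T_L^{(k+1)}`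
— for `ℝ^N`-valued fields take the product of the site set with `Fin N`), read for the SCALAR field in the background
`B^{(k+1)}`, which is precisely the reading its own docstrings display (`H` ↤ `−Δ^{η,N}_{B^{(k+1)}} + m²(L^kε)²`, `Qk, Qks` ↤
`Q_k(B^{(k+1)}), Q*_k(B^{(k+1)})` (2.11), `Q, Qs` ↤ `Q(B^{(k+1)}), Q*(B^{(k+1)})` (2.7), `α` ↤ `a_k`, `β` ↤ `aL⁻²`; derived
`Gk` ↤ `G_k(B^{(k+1)})` (2.20)/(2.22), `Δk` ↤ `Δ^{(k)}(B^{(k+1)})` (2.21), `Ck` ↤ `C^{(k)}(B^{(k+1)})` (2.30), `γ` ↤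
`a_{k+1}L⁻²` (2.13), `Gk1` ↤ `G^η_{k+1}(B^{(k+1)})`, `Qk1s = Q*_kQ*` ↤ `Q*_{k+1}(B^{(k+1)})`), under the hypotheses `B1RG242`
uses for (2.41)/(2.42): `QQ* = 1`, `α + β ≠ 0`, invertibility of the arguments of `G_k` (2.20) and `C^{(k)}` (2.30).

WHAT THIS FILE PROVES (theorems only — no `def`, no new `Prop` fact; 0 `sorry`; standard axioms):
* `eq349` — **(3.49)**: `a_kG_kQ*_k(φ′ + βC^{(k)}Q*ψ) = a_kG_kQ*_kφ′ + γ·G_{k+1}Q*_{k+1}ψ`, i.e. `φ^{(k)}[φ′ + aL⁻²CQ*ψ] =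
  φ′^{(k)} + ψ^{(k+1)}` (= `B1Eq333Decomposition.eq342` read for the scalar field; linearity + the middle identity
  `a_kaL⁻²G_kQ*_kC^{(k)}Q* = a_{k+1}L⁻²G_{k+1}Q*_{k+1}`, which IS `B1Eq333Decomposition.eq342_op` — not restated);
* `eq349_printed` — the same in the vocabulary of the rows of record (`B1LowerBound.bgField` (3.29),
  `B1Sect3Statements.transl310` (3.48)) with the printed coefficients `a_k = B1.aSeq a L k`, `a_{k+1} = B1.aSeq a L (k+1)`
  ((2.13)/(2.15)) at a general spacing `ℓ`, and **`eq349_unit`** — on the unit lattice of p. 619 (`ℓ = 1`): LITERALLY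
  `φ^{(k)}[transl310 (aL⁻²) C^{(k)} Q* φ′ ψ] = bgField a_k 1 G_k Q*_k φ′ + bgField a_{k+1} L G_{k+1} Q*_{k+1} ψ`;
* `secondTerm353_at_zero` — the remark of p. 621 used at (3.53): at `A′^{(k)} = 0` the second term of (3.53) IS `ψ^{(k+1)}`.
HONEST SCOPE.  Model instance on the abstract-matrix carrier (the operators are data with the displayed algebraic
properties; their construction from the lattice, rows B1.Eq2.7/2.11/2.20/2.30, is `HiggsAveraging`/`HiggsCovariance`).
Unit `lit-balaban-p14` gen 3 (Phase-2 proof seat p14, literature-prover-lit-balaban-p14-g3-0), HOME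
`run/shared/lean/pub/lit-balaban/` (seat log `lit-balaban-p14/STATUS.md`).
-/

namespace Literature.MathematicalPhysics.QuantumFieldTheory.Balaban1983to89.B1Eq349Proof

open Literature.MathematicalPhysics.QuantumFieldTheory.Balaban1983to89
open Matrix B1RG242 B1RG242.StepData B1Sect3Statements B1Eq333Decomposition

variable {ι κ ν : Type} [Fintype ι] [Fintype κ] [Fintype ν] [DecidableEq ι] [DecidableEq κ] [DecidableEq ν]
variable (S : B1RG242.StepData ℝ ι κ ν)

/-- **(3.49) p. 621, PROVED** on `B1RG242.StepData` read for the scalar field in the background `B^{(k+1)}`: for every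
fluctuation field `φ′` (on `T₁^{(k)}` ↤ `κ`) and block field `ψ` (on `T_L^{(k+1)}` ↤ `ν`), the background field (3.29) of the
translated field (3.48) splits as `αG_kQ*_k(φ′ + βC^{(k)}Q*ψ) = αG_kQ*_kφ′ + γG_{k+1}Q*_{k+1}ψ`, i.e. *"if (3.48) is done in
φ^{(k)} = a_kG_k(B^{(k+1)})Q*_k(B^{(k+1)})φ, then … φ^{(k)} = φ′^{(k)} + ψ^{(k+1)}"* (`α, β, γ` ↤ `a_k, aL⁻², a_{k+1}L⁻²`);
the operator identity behind it (*"we use (2.66), (3.70)"* = (2.41)–(2.42)), `αβ·G_kQ*_kC^{(k)}Q* = γ·G_{k+1}Q*_{k+1}`, is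
`B1Eq333Decomposition.eq342_op`. [cite: Balaban1982Higgs1, (3.49) p.621] -/
theorem eq349 (hQ : S.Q * S.Qs = 1) (hαβ : S.α + S.β ≠ 0) (hG : IsUnit (S.H + S.α • S.Pk))
    (hC : IsUnit (S.β • S.P + S.Δk)) (φ' : κ → ℝ) (ψ : ν → ℝ) :
    S.α • ((S.Gk * S.Qks) *ᵥ (φ' + S.β • (S.Ck *ᵥ (S.Qs *ᵥ ψ))))
      = S.α • ((S.Gk * S.Qks) *ᵥ φ') + S.γ • ((S.Gk1 * S.Qk1s) *ᵥ ψ) :=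
  eq342 S hQ hαβ hG hC φ' ψ

/-- **(3.49) in the vocabulary of the rows of record** at a general spacing `ℓ` of the level-k lattice: with `α = a_kℓ⁻²`,
`β = a(Lℓ)⁻²` (`a_k = B1.aSeq a L k`, (2.15)), `φ^{(k)}[transl310 β C^{(k)} Q* φ′ ψ] = φ′^{(k)} + ψ^{(k+1)}` where `φ^{(k)}[X] =
bgField a_k ℓ G_k Q*_k X` and `ψ^{(k+1)} = bgField a_{k+1} (Lℓ) G_{k+1} Q*_{k+1} ψ` ((3.29), `a_{k+1} = B1.aSeq a L (k+1)` by (2.13)).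
[cite: Balaban1982Higgs1, (3.49) p.621] -/
theorem eq349_printed {a L ℓ : ℝ} {k : ℕ} (ha : 0 < a) (hL : 1 < L) (hk : 1 ≤ k) (hℓ : 0 < ℓ)
    (hQ : S.Q * S.Qs = 1) (hG : IsUnit (S.H + S.α • S.Pk)) (hC : IsUnit (S.β • S.P + S.Δk))
    (hα : S.α = B1.aSeq a L k * (ℓ ^ 2)⁻¹) (hβ : S.β = a * ((L * ℓ) ^ 2)⁻¹) (φ' : κ → ℝ) (ψ : ν → ℝ) :
    B1LowerBound.bgField (B1.aSeq a L k) ℓ S.Gk.mulVecLin S.Qks.mulVecLin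
        (transl310 S.β S.Ck.mulVecLin S.Qs.mulVecLin φ' ψ)
      = B1LowerBound.bgField (B1.aSeq a L k) ℓ S.Gk.mulVecLin S.Qks.mulVecLin φ'
        + B1LowerBound.bgField (B1.aSeq a L (k + 1)) (L * ℓ) S.Gk1.mulVecLin S.Qk1s.mulVecLin ψ :=
  eq342_printed S ha hL hk hℓ hQ hG hC hα hβ φ' ψ

/-- **(3.49) on the unit lattice `T₁^{(k)}` of p. 619, LITERALLY**: with `α = a_k`, `β = aL⁻²` the background field of the
translated field `φ′ + aL⁻²C^{(k)}(B^{(k+1)})Q*(B^{(k+1)})ψ` (3.48) is `a_kG_k(B^{(k+1)})Q*_k(B^{(k+1)})φ′ +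
a_{k+1}L⁻²G_{k+1}(B^{(k+1)})Q*_{k+1}(B^{(k+1)})ψ = φ′^{(k)} + ψ^{(k+1)}` (`bgField a_k 1 …`, `bgField a_{k+1} L …`, cf.
`B1Ineq352Proof`/`B1Ineq353Proof`). [cite: Balaban1982Higgs1, (3.49) p.621] -/
theorem eq349_unit {a L : ℝ} {k : ℕ} (ha : 0 < a) (hL : 1 < L) (hk : 1 ≤ k)
    (hQ : S.Q * S.Qs = 1) (hG : IsUnit (S.H + S.α • S.Pk)) (hC : IsUnit (S.β • S.P + S.Δk))
    (hα : S.α = B1.aSeq a L k) (hβ : S.β = a * (L ^ 2)⁻¹) (φ' : κ → ℝ) (ψ : ν → ℝ) :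
    B1LowerBound.bgField (B1.aSeq a L k) 1 S.Gk.mulVecLin S.Qks.mulVecLin
        (transl310 (a * (L ^ 2)⁻¹) S.Ck.mulVecLin S.Qs.mulVecLin φ' ψ)
      = B1LowerBound.bgField (B1.aSeq a L k) 1 S.Gk.mulVecLin S.Qks.mulVecLin φ'
        + B1LowerBound.bgField (B1.aSeq a L (k + 1)) L S.Gk1.mulVecLin S.Qk1s.mulVecLin ψ := by
  have hα' : S.α = B1.aSeq a L k * ((1 : ℝ) ^ 2)⁻¹ := by rw [hα]; simp
  have hβ' : S.β = a * ((L * 1) ^ 2)⁻¹ := by rw [hβ, mul_one]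
  have h := eq349_printed S ha hL hk one_pos hQ hG hC hα' hβ' φ' ψ
  rw [mul_one, hβ] at h
  exact h

/-- The remark of p. 621 used in the expansion of (3.53) (*"the first term of this expansion is equal to ψ^{(k+1)}"*): at
`A′^{(k)} = 0`, i.e. with all operators in the background `B^{(k+1)}` as in this instance, the second term of (3.53)
`a_kaL⁻²G_kQ*_kC^{(k)}Q*ψ` IS `ψ^{(k+1)} = a_{k+1}L⁻²G_{k+1}Q*_{k+1}ψ`. [cite: Balaban1982Higgs1, (3.53) p.621] -/
theorem secondTerm353_at_zero (hQ : S.Q * S.Qs = 1) (hαβ : S.α + S.β ≠ 0) (hG : IsUnit (S.H + S.α • S.Pk))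
    (hC : IsUnit (S.β • S.P + S.Δk)) (ψ : ν → ℝ) :
    S.α • ((S.Gk * S.Qks) *ᵥ (S.β • (S.Ck *ᵥ (S.Qs *ᵥ ψ)))) = S.γ • ((S.Gk1 * S.Qk1s) *ᵥ ψ) := by
  have h := eq349 S hQ hαβ hG hC 0 ψ
  simpa using h

end Literature.MathematicalPhysics.QuantumFieldTheory.Balaban1983to89.B1Eq349Proof
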